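import Summits.QuantumFields.BalabanUV.Beta.FP.PerfectPropagatorKernel
import Summits.QuantumFields.BalabanUV.Beta.FP.BlockAveragedKernelLegs
import Literature.MathematicalPhysics.QuantumFieldTheory.Balaban1983to89.B4Reflection242
import Literature.MathematicalPhysics.QuantumFieldTheory.Balaban1983to89.B4BoxCov237
import Literature.MathematicalPhysics.QuantumFieldTheory.Balaban1983to89.B4TorusKernel
import Summits.QuantumFields.BalabanUV.Beta.GAN24.WoodburyFibreLandauLimit

/-!
# `BalabanUV.Beta.FP.PerfectPropagatorKernelLegs` — road «FP» for binder row D1, leaf H2-P, row **H2-P-KER-ASM v1**, sequel of `FP/PerfectPropagatorKernel`: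
# (K2′)∕(K3′) the first ∕ second differences of the remainder kernel `KB` at the HONEST exponent 3, the all-`z` letters `(‖z‖_∞+1)⁻²∕⁻³`, and the CONSUMER
# CURRENCY of IR-1-ABS for `P := Re PinfKer` at `d + 1 = 4` (owner's request, CLAIMS l.21970): `abs_re_PinfKer_le`, `abs_re_PinfKer_fwdDiff_le`

HONEST DEPENDENCY (page 1, mandatory): continuum YM on T⁴ ⇐ BetaPertH ∧ nine spine estimates (0/9 proved); BetaPertH ⇐ (D1) ∧ (D4) ∧ CAP+tail;
G-an2-4 gates asym, D1 and NE2/3/4.  HONEST FRAMING (cell contract, verbatim): «discharging `BetaPertH` makes Bałaban's UV stability UNCONDITIONAL —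
a real constructive-QFT result; it is NOT the continuum limit and NOT the Clay problem.»  THIS MODULE DISCHARGES NOTHING of the wall: (K2′)∕(K3′) are the TRIVIAL
corollaries of (K1) `‖KB z‖ ≤ CKB∕‖z‖_∞³` and the global bound `‖KB‖ ≤ CB0` (`FP/PerfectPropagatorKernel`, p238743) — NO extra integration by parts; the exponents
4∕5 of the row text ((K2)∕(K3)) are v1.1 on the order-5 chain (R-FP-21 (B3)).  The free leg enters through gan24-leaf-04's `BlockAveragedKernelLegs.letter_free` ∕
`letterDiff_free` (an3's `TwoPowerLegs.free`, Lawler–Limic in the tree) BY NAME.  No `def`, no `def … : Prop`, nothing cited, 0 sorry; 0 wall binders; NOT D1, NOT BetaPertH,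
NOT continuum, NOT Clay.

ABSOLUTE RULE (cell charter, verbatim): «No internally-minted statement may enter as a cited fact. Every hypothesis is either kernel-proved in this package or a
verbatim quotation of a PUBLISHED theorem with page reference. The manuscript(s) under audit are NOT citable for their own disputed steps — they are the thing
under adjudication; programme-internal (2001/route/tribunal) claims are never citable.»

WHAT (`‖·‖_∞ = B4ContourShift.supNorm`, lattice dimension `d + 1`, `3 ≤ d` where (K1) is used):
* §1 [folklore] sup-norm bookkeeping on `ℤ^{d+1}` (reusing the tree's `B4BoxCov237.supNorm_zero'`, `B4Reflection242.supNorm_add_le`, `B4TorusKernel.supNorm_neg`,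
  `GAN24.WoodburyFibreLandauLimit.supNorm_single` BY NAME): `one_le_supNorm`, `supNorm_sub_le_supNorm_add`; the bridge
  `supNorm_cast_eq : (DyadicShell.supNorm z : ℝ) = B4ContourShift.supNorm z` on `ℤ⁴`.
* §2 [our object] `CKB_nonneg`; the SHIFT LEMMA `norm_KB_add_le : ‖y‖_∞ ≤ m → z ≠ 0 → ‖KB α β (z + y)‖ ≤ 8·(CKB d + m³·CB0 d)∕‖z‖_∞³`;
  **(K2′) `norm_KB_fwdDiff_le : ‖KB α β (z + e_j) − KB α β z‖ ≤ (8(CKB d + CB0 d) + CKB d)∕‖z‖_∞³`** and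
  **(K3′) `norm_KB_fwdDiff₂_le : ‖KB(z+e_i+e_j) − KB(z+e_i) − KB(z+e_j) + KB z‖ ≤ (8(CKB d + 8·CB0 d) + 16(CKB d + CB0 d) + CKB d)∕‖z‖_∞³`** (`z ≠ 0`).
* §3 [our object] ALL-`z` LETTERS: `norm_KB_le_inv_succ_sq : ‖KB α β z‖ ≤ 4(CKB d + CB0 d)∕(‖z‖_∞+1)²`, `norm_KB_fwdDiff_le_inv_succ_cube :
  ‖KB(z+e_j) − KB z‖ ≤ 8(8(CKB d + CB0 d) + CKB d)∕(‖z‖_∞+1)³`.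
* §4 [our object] THE CONSUMER CURRENCY OF IR-1-ABS (`d + 1 = 4`, `P := Re PinfKer α β`, `DyadicShell.supNorm`): **`abs_re_PinfKer_le`**:
  `|P z| ≤ (4(U₀ + c₄ + B₀) + 4(CKB 3 + CB0 3))∕(‖z‖_∞+1)²` and **`abs_re_PinfKer_fwdDiff_le`**: `|P(z+e_μ) − P z| ≤ (8(2U₀ + 2c₄ + Bgrad₀) + 8(8(CKB 3 + CB0 3) + CKB 3))∕(‖z‖_∞+1)³`
  (`re_PinfKer` + the free letters + §3).
Provenance: G-an2-4 swarm leaf prover 05, gen 35 (prover-b2b-balaban-gan24-formalise-leaf-05-g35-0), cross-lane on road FP (INTENT l.21819, owner GO l.21970), 2026-08-20.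
-/

noncomputable section

namespace Summit.QuantumFields.BalabanUV.Beta.FP.PerfectPropagatorKernelLegs

open Finset
open scoped Real BigOperators
open Literature.MathematicalPhysics.QuantumFieldTheory.Balaban1983to89
open Literature.MathematicalPhysics.QuantumFieldTheory.Balaban1983to89.Beta
open B4ContourShift (supNorm abs_le_supNorm supNorm_nonneg)
open B4Reflection242 (supNorm_add_le)
open B4BoxCov237 (supNorm_zero')
open B4TorusKernel (supNorm_neg)
open Summit.QuantumFields.BalabanUV.Beta.GAN24.WoodburyFibreLandauLimit (supNorm_single)
open Literature.MathematicalPhysics.QuantumFieldTheory.Balaban1983to89.Beta.DyadicShell (Pt)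
open Literature.MathematicalPhysics.QuantumFieldTheory.Balaban1983to89.Beta.BubbleTransfer (c4 c4_pos)
open Literature.MathematicalPhysics.QuantumFieldTheory.Balaban1983to89.Beta.TwoPowerLegs (free)
open Literature.Probability.LatticeModels (latticeGreen)
open Summit.QuantumFields.BalabanUV.Beta.FP.PerfectPropagatorKernel (KB PinfKer CKB CB0 CB0_nonneg norm_KB_le norm_KB_le_div_supNorm_cube re_PinfKer)
open Summit.QuantumFields.BalabanUV.Beta.FP.BlockAveragedKernelLegs (letter_free letterDiff_free)

variable {d : ℕ}

/-! ## §1 Sup-norm bookkeeping on `ℤ^{d+1}` -/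

/-- [folklore] a non-zero lattice point has `1 ≤ ‖z‖_∞`. -/
theorem one_le_supNorm {z : Fin (d + 1) → ℤ} (hz : z ≠ 0) : 1 ≤ supNorm z := by
  obtain ⟨i, hi⟩ : ∃ i, z i ≠ 0 := by
    by_contra h; push Not at h; exact hz (funext h)
  have h1 : (1 : ℝ) ≤ ((|z i| : ℤ) : ℝ) := by exact_mod_cast Int.one_le_abs hi
  exact h1.trans (abs_le_supNorm z i)

/-- [folklore] the reverse triangle inequality `‖z‖_∞ − ‖y‖_∞ ≤ ‖z + y‖_∞`. -/
theorem supNorm_sub_le_supNorm_add (z y : Fin (d + 1) → ℤ) : supNorm z - supNorm y ≤ supNorm (z + y) := by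
  have h := supNorm_add_le (z + y) (-y)
  rw [add_neg_cancel_right, supNorm_neg] at h
  linarith

/-- [folklore] THE BRIDGE between the cell's two sup norms on `ℤ⁴`: `(DyadicShell.supNorm z : ℝ) = B4ContourShift.supNorm z`. -/
theorem supNorm_cast_eq (z : Pt) : ((DyadicShell.supNorm z : ℕ) : ℝ) = supNorm z := by
  apply le_antisymm
  · obtain ⟨i, hi⟩ := DyadicShell.exists_eq_supNorm z
    rw [← hi]
    have e : (((z i).natAbs : ℕ) : ℝ) = ((|z i| : ℤ) : ℝ) := by rw [← Int.natCast_natAbs, Int.cast_natCast]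
    rw [e]; exact abs_le_supNorm z i
  · unfold B4ContourShift.supNorm
    refine Finset.sup'_le _ _ fun i _ => ?_
    have h := DyadicShell.natAbs_le_supNorm z i
    have e : ((|z i| : ℤ) : ℝ) = (((z i).natAbs : ℕ) : ℝ) := by rw [← Int.natCast_natAbs, Int.cast_natCast]
    rw [e]; exact_mod_cast h

/-! ## §2 (K2′)∕(K3′): differences of the remainder kernel at exponent 3 -/

/-- [our object] `0 ≤ CKB d` (`3 ≤ d`): (K1) at the point `e_0`. -/
theorem CKB_nonneg (hd : 3 ≤ d) : 0 ≤ CKB d := by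
  have hz : (Pi.single (0 : Fin (d + 1)) (1 : ℤ) : Fin (d + 1) → ℤ) ≠ 0 := by
    intro h; have := congrFun h 0; simp at this
  have h := norm_KB_le_div_supNorm_cube hd 0 0 hz
  have hs : 0 < supNorm (Pi.single (0 : Fin (d + 1)) (1 : ℤ)) := lt_of_lt_of_le one_pos (one_le_supNorm hz)
  have h0 : 0 ≤ CKB d / supNorm (Pi.single (0 : Fin (d + 1)) (1 : ℤ)) ^ 3 := (norm_nonneg _).trans h
  by_contra hneg
  push Not at hneg
  have : CKB d / supNorm (Pi.single (0 : Fin (d + 1)) (1 : ℤ)) ^ 3 < 0 := div_neg_of_neg_of_pos hneg (pow_pos hs 3)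
  linarith

/-- [our object] THE SHIFT LEMMA: for `‖y‖_∞ ≤ m` (`0 ≤ m`) and `z ≠ 0`, `‖KB α β (z + y)‖ ≤ 8·(CKB d + m³·CB0 d)∕‖z‖_∞³` — far out (`2m ≤ ‖z‖_∞`) by (K1) at `z + y`
(`‖z + y‖_∞ ≥ ‖z‖_∞∕2`), close in by the global bound. -/
theorem norm_KB_add_le (hd : 3 ≤ d) (α β : Fin (d + 1)) {m : ℝ} (hm : 0 ≤ m) {z y : Fin (d + 1) → ℤ} (hz : z ≠ 0) (hy : supNorm y ≤ m) :
    ‖KB α β (z + y)‖ ≤ 8 * (CKB d + m ^ 3 * CB0 d) / supNorm z ^ 3 := by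
  have hC := CKB_nonneg hd; have hB := CB0_nonneg d
  set a := supNorm z with ha
  have ha1 : 1 ≤ a := one_le_supNorm hz
  have ha0 : 0 < a := by linarith
  by_cases hfar : 2 * m ≤ a
  · -- far out: `z + y ≠ 0` and `‖z + y‖ ≥ a/2`
    have hzy : a / 2 ≤ supNorm (z + y) := by
      have := supNorm_sub_le_supNorm_add z y; linarith
    have hne : z + y ≠ 0 := by
      intro h0; rw [h0, supNorm_zero'] at hzy; linarith
    have h1 := norm_KB_le_div_supNorm_cube hd α β hne
    have hpos : 0 < supNorm (z + y) ^ 3 := pow_pos (by linarith) 3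
    calc ‖KB α β (z + y)‖ ≤ CKB d / supNorm (z + y) ^ 3 := h1
      _ ≤ CKB d / (a / 2) ^ 3 := div_le_div_of_nonneg_left hC (by positivity) (pow_le_pow_left₀ (by positivity) hzy 3)
      _ = 8 * CKB d / a ^ 3 := by field_simp; ring
      _ ≤ 8 * (CKB d + m ^ 3 * CB0 d) / a ^ 3 := by gcongr; nlinarith [pow_nonneg hm 3]
  · -- close in: the global bound, `1 ≤ (2m/a)³`
    push Not at hfar
    have h1 := norm_KB_le α β (z + y)
    have h2 : CB0 d ≤ 8 * (CKB d + m ^ 3 * CB0 d) / a ^ 3 := by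
      rw [le_div_iff₀ (pow_pos ha0 3)]
      have : a ^ 3 ≤ (2 * m) ^ 3 := pow_le_pow_left₀ ha0.le hfar.le 3
      nlinarith [pow_nonneg ha0.le 3]
    exact h1.trans h2

/-- [our object] **(K2′) THE FIRST DIFFERENCE OF THE REMAINDER KERNEL AT EXPONENT 3**: `‖KB α β (z + e_j) − KB α β z‖ ≤ (8(CKB d + CB0 d) + CKB d)∕‖z‖_∞³`, `z ≠ 0`. -/
theorem norm_KB_fwdDiff_le (hd : 3 ≤ d) (α β j : Fin (d + 1)) {z : Fin (d + 1) → ℤ} (hz : z ≠ 0) :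
    ‖KB α β (z + Pi.single j 1) - KB α β z‖ ≤ (8 * (CKB d + CB0 d) + CKB d) / supNorm z ^ 3 := by
  have h1 := norm_KB_add_le hd α β zero_le_one hz (supNorm_single j)
  have h2 := norm_KB_le_div_supNorm_cube hd α β hz
  rw [one_pow, one_mul] at h1
  calc ‖KB α β (z + Pi.single j 1) - KB α β z‖ ≤ ‖KB α β (z + Pi.single j 1)‖ + ‖KB α β z‖ := norm_sub_le _ _
    _ ≤ 8 * (CKB d + CB0 d) / supNorm z ^ 3 + CKB d / supNorm z ^ 3 := add_le_add h1 h2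
    _ = (8 * (CKB d + CB0 d) + CKB d) / supNorm z ^ 3 := by ring

/-- [our object] **(K3′) THE SECOND DIFFERENCE OF THE REMAINDER KERNEL AT EXPONENT 3**:
`‖KB(z+e_i+e_j) − KB(z+e_i) − KB(z+e_j) + KB z‖ ≤ (8(CKB d + 8·CB0 d) + 16(CKB d + CB0 d) + CKB d)∕‖z‖_∞³`, `z ≠ 0`. -/
theorem norm_KB_fwdDiff₂_le (hd : 3 ≤ d) (α β i j : Fin (d + 1)) {z : Fin (d + 1) → ℤ} (hz : z ≠ 0) :
    ‖KB α β (z + Pi.single i 1 + Pi.single j 1) - KB α β (z + Pi.single i 1) - KB α β (z + Pi.single j 1) + KB α β z‖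
      ≤ (8 * (CKB d + 8 * CB0 d) + 16 * (CKB d + CB0 d) + CKB d) / supNorm z ^ 3 := by
  have hij : supNorm (Pi.single i (1 : ℤ) + Pi.single j 1) ≤ 2 := by
    have := supNorm_add_le (Pi.single i (1 : ℤ)) (Pi.single j 1)
    linarith [supNorm_single (d := d) i, supNorm_single (d := d) j]
  have h2 := norm_KB_add_le hd α β (by norm_num : (0 : ℝ) ≤ 2) hz hij
  have hi := norm_KB_add_le hd α β zero_le_one hz (supNorm_single i)
  have hj := norm_KB_add_le hd α β zero_le_one hz (supNorm_single j)
  have h0 := norm_KB_le_div_supNorm_cube hd α β hz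
  rw [one_pow, one_mul] at hi hj
  rw [add_assoc z]
  calc ‖KB α β (z + (Pi.single i 1 + Pi.single j 1)) - KB α β (z + Pi.single i 1) - KB α β (z + Pi.single j 1) + KB α β z‖
      ≤ ‖KB α β (z + (Pi.single i 1 + Pi.single j 1))‖ + ‖KB α β (z + Pi.single i 1)‖ + ‖KB α β (z + Pi.single j 1)‖ + ‖KB α β z‖ := by
        refine (norm_add_le _ _).trans (add_le_add ((norm_sub_le _ _).trans (add_le_add (norm_sub_le _ _) le_rfl)) le_rfl)
    _ ≤ 8 * (CKB d + 2 ^ 3 * CB0 d) / supNorm z ^ 3 + 8 * (CKB d + CB0 d) / supNorm z ^ 3 + 8 * (CKB d + CB0 d) / supNorm z ^ 3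
        + CKB d / supNorm z ^ 3 := add_le_add (add_le_add (add_le_add h2 hi) hj) h0
    _ = (8 * (CKB d + 8 * CB0 d) + 16 * (CKB d + CB0 d) + CKB d) / supNorm z ^ 3 := by ring

/-! ## §3 All-`z` letters in the `(‖z‖_∞ + 1)` currency -/

/-- [our object] `‖KB α β z‖ ≤ 4·(CKB d + CB0 d)∕(‖z‖_∞ + 1)²` for EVERY `z` (at `z = 0` the global bound; else (K1) with `(a+1)² ≤ 4a²`, `a³ ≥ a²`). -/
theorem norm_KB_le_inv_succ_sq (hd : 3 ≤ d) (α β : Fin (d + 1)) (z : Fin (d + 1) → ℤ) :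
    ‖KB α β z‖ ≤ 4 * (CKB d + CB0 d) / (supNorm z + 1) ^ 2 := by
  have hC := CKB_nonneg hd; have hB := CB0_nonneg d
  by_cases hz : z = 0
  · subst hz
    rw [supNorm_zero', zero_add, one_pow, div_one]
    exact (norm_KB_le α β 0).trans (by linarith)
  · set a := supNorm z with ha
    have ha1 : 1 ≤ a := one_le_supNorm hz
    have h1 := norm_KB_le_div_supNorm_cube hd α β hz
    have ha0 : 0 ≤ a := by linarith
    have h2 : CKB d / a ^ 3 ≤ 4 * (CKB d + CB0 d) / (a + 1) ^ 2 := by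
      rw [div_le_div_iff₀ (by positivity) (by positivity)]
      have h3 : (a + 1) ^ 2 ≤ (2 * a) ^ 2 := pow_le_pow_left₀ (by linarith) (by linarith) 2
      have h4 : a ^ 2 ≤ a ^ 3 := by nlinarith [mul_nonneg (sq_nonneg a) (by linarith : (0:ℝ) ≤ a - 1)]
      have h5 : (a + 1) ^ 2 ≤ 4 * a ^ 3 := by nlinarith
      calc CKB d * (a + 1) ^ 2 ≤ CKB d * (4 * a ^ 3) := mul_le_mul_of_nonneg_left h5 hC
        _ ≤ 4 * (CKB d + CB0 d) * a ^ 3 := by nlinarith [mul_nonneg hB (pow_nonneg ha0 3)]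
    exact h1.trans h2

/-- [our object] `‖KB α β (z + e_j) − KB α β z‖ ≤ 8·(8(CKB d + CB0 d) + CKB d)∕(‖z‖_∞ + 1)³` for EVERY `z`. -/
theorem norm_KB_fwdDiff_le_inv_succ_cube (hd : 3 ≤ d) (α β j : Fin (d + 1)) (z : Fin (d + 1) → ℤ) :
    ‖KB α β (z + Pi.single j 1) - KB α β z‖ ≤ 8 * (8 * (CKB d + CB0 d) + CKB d) / (supNorm z + 1) ^ 3 := by
  have hC := CKB_nonneg hd; have hB := CB0_nonneg d
  by_cases hz : z = 0
  · have e : supNorm z = 0 := by rw [hz]; exact supNorm_zero'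
    rw [e, zero_add, one_pow, div_one]
    calc ‖KB α β (z + Pi.single j 1) - KB α β z‖ ≤ ‖KB α β (z + Pi.single j 1)‖ + ‖KB α β z‖ := norm_sub_le _ _
      _ ≤ CB0 d + CB0 d := add_le_add (norm_KB_le α β _) (norm_KB_le α β _)
      _ ≤ 8 * (8 * (CKB d + CB0 d) + CKB d) := by linarith
  · set a := supNorm z with ha
    have ha1 : 1 ≤ a := one_le_supNorm hz
    have h1 := norm_KB_fwdDiff_le hd α β j hz
    have hK : 0 ≤ 8 * (CKB d + CB0 d) + CKB d := by positivity
    have ha0 : 0 ≤ a := by linarith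
    have h2 : (8 * (CKB d + CB0 d) + CKB d) / a ^ 3 ≤ 8 * (8 * (CKB d + CB0 d) + CKB d) / (a + 1) ^ 3 := by
      rw [div_le_div_iff₀ (by positivity) (by positivity)]
      have h3 : (a + 1) ^ 3 ≤ (2 * a) ^ 3 := pow_le_pow_left₀ (by linarith) (by linarith) 3
      have h5 : (a + 1) ^ 3 ≤ 8 * a ^ 3 := by nlinarith
      calc (8 * (CKB d + CB0 d) + CKB d) * (a + 1) ^ 3 ≤ (8 * (CKB d + CB0 d) + CKB d) * (8 * a ^ 3) := mul_le_mul_of_nonneg_left h5 hK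
        _ = 8 * (8 * (CKB d + CB0 d) + CKB d) * a ^ 3 := by ring
    exact h1.trans h2

/-! ## §4 The consumer currency of IR-1-ABS: `P := Re PinfKer` on `ℤ⁴` -/

/-- [folklore] the free constants are non-negative (as a sum). -/
theorem free_letter_const_nonneg : 0 ≤ free.U + c4 + free.B := by
  have := free.nonneg_U; have := free.nonneg_B; have := c4_pos; positivity

/-- [our object] **IR-1-ABS's VALUE LETTER FOR THE PERFECT PROPAGATOR KERNEL** (`d + 1 = 4`, `P := Re PinfKer α β`):
`|P z| ≤ (4(U₀ + c₄ + B₀) + 4(CKB 3 + CB0 3))∕(‖z‖_∞ + 1)²` for every `z ∈ ℤ⁴` — the free leg by `BlockAveragedKernelLegs.letter_free`, the remainder by §3. -/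
theorem abs_re_PinfKer_le (α β : Fin (3 + 1)) (z : Pt) :
    |(PinfKer α β z).re| ≤ (4 * (free.U + c4 + free.B) + 4 * (CKB 3 + CB0 3)) / ((DyadicShell.supNorm z : ℝ) + 1) ^ 2 := by
  have hd : (3 : ℕ) ≤ 3 := le_rfl
  rw [re_PinfKer (by norm_num) α β z, supNorm_cast_eq, add_div]
  have hK : |(KB α β z).re| ≤ 4 * (CKB 3 + CB0 3) / (supNorm z + 1) ^ 2 :=
    (Complex.abs_re_le_norm _).trans (norm_KB_le_inv_succ_sq hd α β z)
  have hF : |(if α = β then latticeGreen z / 2 else 0)| ≤ 4 * (free.U + c4 + free.B) / (supNorm z + 1) ^ 2 := by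
    by_cases hab : α = β
    · rw [if_pos hab, ← supNorm_cast_eq]; exact letter_free z
    · rw [if_neg hab, abs_zero]; have := free_letter_const_nonneg; have := supNorm_nonneg z; positivity
  exact (abs_add_le _ _).trans (add_le_add hF hK)

/-- [our object] **IR-1-ABS's DIFFERENCE LETTER FOR THE PERFECT PROPAGATOR KERNEL** (`d + 1 = 4`):
`|P (z + e_μ) − P z| ≤ (8(2U₀ + 2c₄ + Bgrad₀) + 8(8(CKB 3 + CB0 3) + CKB 3))∕(‖z‖_∞ + 1)³` for every `z ∈ ℤ⁴`. -/
theorem abs_re_PinfKer_fwdDiff_le (α β : Fin (3 + 1)) (μ : Fin (3 + 1)) (z : Pt) :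
    |(PinfKer α β (z + Pi.single μ 1)).re - (PinfKer α β z).re|
      ≤ (8 * (2 * free.U + 2 * c4 + free.Bgrad) + 8 * (8 * (CKB 3 + CB0 3) + CKB 3)) / ((DyadicShell.supNorm z : ℝ) + 1) ^ 3 := by
  have hd : (3 : ℕ) ≤ 3 := le_rfl
  rw [re_PinfKer (by norm_num) α β, re_PinfKer (by norm_num) α β z, supNorm_cast_eq, add_div]
  have hK : |(KB α β (z + Pi.single μ 1)).re - (KB α β z).re| ≤ 8 * (8 * (CKB 3 + CB0 3) + CKB 3) / (supNorm z + 1) ^ 3 := by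
    rw [← Complex.sub_re]
    exact (Complex.abs_re_le_norm _).trans (norm_KB_fwdDiff_le_inv_succ_cube hd α β μ z)
  have hF : |(if α = β then latticeGreen (z + Pi.single μ 1) / 2 else 0) - (if α = β then latticeGreen z / 2 else 0)|
      ≤ 8 * (2 * free.U + 2 * c4 + free.Bgrad) / (supNorm z + 1) ^ 3 := by
    by_cases hab : α = β
    · rw [if_pos hab, if_pos hab, ← supNorm_cast_eq]; exact letterDiff_free μ z
    · rw [if_neg hab, if_neg hab, sub_zero, abs_zero]
      have := free.nonneg_U; have := free.Bgrad_nonneg; have := c4_pos; have := supNorm_nonneg z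
      positivity
  have e : (if α = β then latticeGreen (z + Pi.single μ 1) / 2 else 0) + (KB α β (z + Pi.single μ 1)).re
      - ((if α = β then latticeGreen z / 2 else 0) + (KB α β z).re)
      = ((if α = β then latticeGreen (z + Pi.single μ 1) / 2 else 0) - (if α = β then latticeGreen z / 2 else 0))
        + ((KB α β (z + Pi.single μ 1)).re - (KB α β z).re) := by ring
  rw [e]
  exact (abs_add_le _ _).trans (add_le_add hF hK)

end Summit.QuantumFields.BalabanUV.Beta.FP.PerfectPropagatorKernelLegs

end
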